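import Literature.MathematicalPhysics.QuantumFieldTheory.Balaban1983to89.B9Cor36BondSandwichTransferSrc
import Literature.MathematicalPhysics.QuantumFieldTheory.Balaban1983to89.B9Ineq3101POneCubeAtLocCfg
import Literature.MathematicalPhysics.QuantumFieldTheory.Balaban1983to89.B9Cor36GCubeLocDefectAtLocCfg
import Literature.MathematicalPhysics.QuantumFieldTheory.Balaban1983to89.B9GeoInputsMultiRateKLevelV1

/-!
# `Balaban1983to89.B9Cor36GCubeFamFourAtLocCfg` — FAMILY 4 OF (3.105), `ζ_□̃·P_{□,1}(∂h_□)·O_□·h_□` AND ITS TRANSPOSED WORD `h_□·O_□·P_{□,1}(∂h_□)`, SUMMED OVER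
# THE COVER CUBES OF A MEMBER AT THE LOCALISED FIELDS: `Σ_□ ≺ Θ₄·(L·M_h)⁻¹·e^{−δ₄d}` (flat, for `hrest`) and `Σ_□ ≺ Θ₄ᵀ·(L·M_h)⁻¹·ℓ(a)ℓ(a′)⁻¹·e^{−δ₄ᵀd}` (for `hV′`),
# UNIFORMLY IN THE MEMBER — p38's α-1∕α-2∕α-T per cube + the finite overlap `3·5^{d+1}` + the datum plug (sub-row G-B9-LETTERS, GAPS G-B9-07 «family 4 of
# (3.105)», programme FAMFOUR, FILE α-3; lead g34 RULING FAMFOUR SPLIT 2026-08-28; design (R) letters, the O(M⁻¹) is print's (3.101))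

statement-level skeleton of published theorems with citation tags; proofs where landed; nothing here is a claim about the Yang–Mills mass gap

THE PRINTED LOCUS (verbatim, held `paper:balaban1985-cmp99-background-propagators`, journal page = PDF page + 388).  p. 414 (3.101) «(DPD*hA)_μ(x) = h(x)(DPD*A)_μ(x) +
(P₁(∂h)A)_μ(x). The operator P₁(∂h) satisfies the inequalities (3.49) with the additional small factor O(M⁻¹) coming from an estimate of the expression (∂h)(Γ_{x,x′})
together with the exponential decay of DPD*»; (3.105) p. 414 («− Σ_□ζ_□̃P_{□,1}(∂h_□)G_□h_□ … R satisfies the bound (3.85) with O(M⁻¹) instead of O(α₁). For M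
sufficiently large …»); (3.91) p. 410; Cor. 3.6 p. 408; p. 409 l. 1–5; (3.49) p. 399; p. 398 remark after (3.47); [4] (2.83)–(2.85) pp. 237–238, p. 247 (Lipschitz
bound of `h`), (2.36) p. 229, Lemma 2.1 (2.60)–(2.61) p. 234.

WHY THIS FILE.  Per cube, p38 g46 landed∕filed: α-1 `B9Ineq3101POneCubeAtLocCfg.hasMajorant_conj_P1CubeY_at_locCfg` (`conj b(P_{□,1}(∂h_□)(Ṽ_□)) ≺
K₁·(L·M_h)⁻¹·ℓ_□⁻²·e^{−δ₁d_□}` under the (3.35) cube datum), α-2 `B9Cor36GCubeFamFourCore.hasMajorant_conj_famFour` (the member-side family-4 word with the COLUMN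
indicator) and α-T `B9Cor36BondSandwichTransferSrc.hasMajorant_conj_famFourT` (the transposed word with the ROW indicator).  THIS FILE is the p33 half of the split:
the cover sums by the finite overlap `Σ_□ 𝟙_□ ≤ 3·5^{d+1}` (p33 D3 `sum_rowInd_le`, read at the column for α-2 and at the row for α-T; r03∕p21 `hasMajorant_localSum(_right)`)
and the datum plug (G-F7 v1.1 for `GVK(Ṽ_□)`, α-1 for `P_{□,1}`, p33 `exists_h261_geoCK`∕`hST_geoCK`, master rate `δ⋆ = min((1−9∕5000)ρ_G, δ₁)`), with the
`(L·M_h)⁻¹` of (3.101) KEPT EXPLICIT (it is the «M sufficiently large» smallness of family 4 in the assembler's `hsmall`∕`hsmallV`), and for `hV′` the member-side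
transfer of `ℓ` (p33 D4 `scaleTransfer_len_geo9K`) under one more member threshold.

WHAT THIS FILE CERTIFIES (kernel-checked; 0 `def`, 0 `def … : Prop`, 0 sorry; standard axioms only)

* §1 ★★ `hasMajorant_sum_famFour` ∕ ★★ `hasMajorant_sum_famFourT` — GIVEN per-cube displayed data of α-2 ∕ α-T (`hP1 □`, `hG □`, (2.61), scale transfers, constants
  uniform in □), any cut-offs `ζ_□` with `|ζ_□| ≤ 1`, bi-contractive `u_□`: the two cover sums over `(toB6 (geo9K i) Rr′ Hp, ιB∘blkV1)` (flat kernels).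
* §2 ★★★ `sum_conj_famFour_at_locCfg'` — CLOSED at the localised fields: `∃ δ₄ Θ₄ M₀ T₀ N₀ a₁, ∀ i (thresholds) ∀ (u A Q C ξ Λ : cubes → …) (datum ∀ □, sRead ≤ a₁, u_□
  bi-contractive) (ζ, |ζ_□| ≤ 1) ∀ [Fintype] ιB hι Rr′ Hp, Σ_□ conj b((M_{ζ_□}·locP1BY …·locLetterBY …·M_{h_□}).rS) ≺ Θ₄·((ℓ+1)·M_h)⁻¹·e^{−δ₄·d(a,a′)} ∧
  Σ_□ conj b((M_{h_□}·locLetterBY …·locP1BY …).rS) ≺ Θ₄·((ℓ+1)·M_h)⁻¹·e^{−δ₄·d(a,a′)}`.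
* §3 ★★★ `sum_conj_famFourT_src_at_locCfg'` — the transposed sum in `hV′`'s currency `Θ·((ℓ+1)·M_h)⁻¹·ℓ(a)·ℓ(a′)⁻¹·e^{−δd}`, CLOSED (one more member threshold).

HONEST SCOPE ∕ NOT CLAIMED.  (i) (R)-design letters `locLetterBY`, `locP1BY` (G-F2); print's family 4 is for `G_□ = (Δ_{loc,□} − DP_□D*)⁻¹`; the O(M⁻¹) mechanism is
print's (3.101) verbatim (α-1).  (ii) DISPLAYED: the (3.35) datum per cube, bi-contractive gauges, `|ζ_□| ≤ 1` (for the ζ of record `B9Eq3105ZetaY.abs_zetaY_le_one`),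
`[NormOneClass 𝔸]`, `[Fintype (geo9K i).Site]`, the member thresholds.  (iii) NOT here: families 2–3 (programme ZETA-2 ∕ the family-3 walk), the knit into
`eBlock_kernelFamilyBInv_GAY_of_localInverseCubes''` and `hsmall` (assembler).  Count-neutral; NOT a node discharge; no summit ∕ sub-problem statement is proved;
nothing continuum ∕ OS ∕ mass-gap ∕ Clay; YM mass gap NOT proved (Track A conditional rung).  No `sorry`, no `axiom`, no `… : Prop` fact, no `instance`, no `notation`,
no `def`.  NEW file; nothing landed is modified.  Cell `lit-balaban`, seat `lit-balaban-p33` gen 102, 2026-08-28; `--supports stmt-QuantumFields-19200` as helper.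
Net new unproved facts: 0.

RELATED IN THE TREE, NOT DUPLICATED (searched 2026-08-28: `rg 'sum_conj_famFour'` = ∅): p38 α-1 `B9Ineq3101POneCubeAtLocCfg`, α-2 `B9Cor36GCubeFamFourCore`, α-T
`B9Cor36BondSandwichTransferSrc`; p33 D3 `B9Cor36GCubeLocDefectCover` (`sum_rowInd_le`, `flat_le_src_weight`), D4 `B9Cor36GCubeLocDefectAtLocCfg` (`scaleTransfer_len_geo9K`),
G-F7 `B9Cor36GCubeAtLocCfg`, `B9CubeGeometryInputs`, `B9GeoInputsMultiRateKLevelV1.ineq261_mono_exp` — all USED BY NAME.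
-/

noncomputable section

namespace Literature.MathematicalPhysics.QuantumFieldTheory.Balaban1983to89.B9Cor36GCubeFamFourAtLocCfg

open NormedSpace Complex
open B6RandomWalk (HasMajorant hasMajorant_mono Ineq261 c1_nonneg)
open B9Thm34Ext (toB6)
open B9Thm37Sum (hasMajorant_localSum)
open B9Thm39Sum (hasMajorant_localSum_right)
open B9Ineq347 (ScaleTransfer)
open B9Eq352DivFormLetters (conj)
open B9Eq39Adjoint (covD)
open B6KLevelCensusIndexV1 (KIdx kGeo)
open B6Cover236MultiLevelBlocks (cubes)
open B6GlobalChartV1 (PV boxEquiv blkV1)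
open B6Geom246MultiLevelBox (blkOf)
open B9BackgroundsKLevelV1 (shiftsV1)
open B6Ineq2142KLevelV1 (β)
open B9GeoNormsKLevelV1 (geo9K geo9K_dist_nonneg)
open B9GeoInputsMultiRateKLevelV1 (ineq261_mono_exp)
open B9Eq360DeltaPrimeAY (AfldY)
open B9Thm37CubeCoverCommutators (cutMulY hTY)
open B9Eq3104CutoffCommutators (hBdY)
open B9Eq3105AtLetters (P1CubeY)
open B9CubeLettersBondOpsL0 (BlkCubeY)
open B9Eq360DeltaPrimeACubeY (blkCubeY)
open B9CubeGeometryInputs (geoCK geoCK_dist_axioms RM1 N1 exists_h261_geoCK hST_geoCK)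
open B9Cor35GCubeInputsAtOne (blkBK GVK)
open B9Cor35CinvAtCubeLetters (kernel_rate_mono)
open B9Cor36CubeCutoffs (SC NearC chiY locCfgY)
open B9Cor36GCubeWindows (sRead)
open B9Cor36GCubeLocLetter (locLetterBY locP1BY)
open B9Cor36GCubeAtLocCfg (cor36_G_cube_at_locCfg')
open B9Cor36GCubeLocDefectCover (sum_rowInd_le flat_le_src_weight)
open B9Cor36GCubeLocDefectAtLocCfg (scaleTransfer_len_geo9K)
open B9Ineq3101POneCubeAtLocCfg (hasMajorant_conj_P1CubeY_at_locCfg)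
open B9Cor36GCubeFamFourCore (hasMajorant_conj_famFour)
open B9Cor36BondSandwichTransferSrc (hasMajorant_conj_famFourT)
open Node00 (SiteY BlkY IBondY FBondY CfgY GaugeY SiteParY BondParY toKT parSymY parBY)
open Node00.OpsYNablaBridge (chartY)

variable {d ℓ : ℕ} {hd : 1 ≤ d + 1} {hL : Odd (ℓ + 1) ∧ 1 < ℓ + 1} {b₀ b₁ : ℝ}
variable {𝔸 : Type} [NormedRing 𝔸] [NormedAlgebra ℂ 𝔸] [CompleteSpace 𝔸]
variable {ι : Type} [Fintype ι]

/-! ## §1  The cover sums for displayed per-cube data -/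

section Cover

variable (i : KIdx d ℓ hd hL b₀ b₁) (parS : SiteParY 𝔸 i) (parB : BondParY 𝔸 i) (b : Module.Basis ι ℝ 𝔸)

open Classical in
set_option maxHeartbeats 1600000 in
/-- ★★ **FAMILY 4 SUMMED OVER THE COVER** (`hrest`'s word, flat kernel): α-2 per cube with the COLUMN indicator, `Σ_□ 𝟙_□(a′) ≤ 3·5^{d+1}` (D3 `sum_rowInd_le` read at the
column), `hasMajorant_localSum_right`.
[cite: Balaban1985BackgroundPropagators, (3.105) p.414, (3.101) p.414, (3.91) p.410, Cor. 3.6 p.408; Balaban1984PropagatorsII, (2.83)–(2.85) pp.237–238, (2.36) p.229, p.235, Lemma 2.1 (2.61) p.234] -/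
theorem hasMajorant_sum_famFour {M₂ : ℝ} (hM₂ : 0 ≤ M₂) (hrepr : ∀ (v : 𝔸) (j : ι), |b.repr v j| ≤ M₂ * ‖v‖)
    (u : ↥(cubes (toKT i).D.toDomains) → GaugeY 𝔸 i) (hu : ∀ c x, ‖((u c x : 𝔸ˣ) : 𝔸)‖ ≤ 1 ∧ ‖(((u c x)⁻¹ : 𝔸ˣ) : 𝔸)‖ ≤ 1)
    (V : ↥(cubes (toKT i).D.toDomains) → CfgY 𝔸 i) (ζ : ↥(cubes (toKT i).D.toDomains) → SiteY i → ℝ) (hζ1 : ∀ c z, |ζ c z| ≤ 1)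
    (ιB : BlkY i → IBondY i) (hι : ∀ s, β i.hN i.D i.hk (ιB s) = s) (Rr : ℝ) (H : Prop) [Fintype (geo9K i).Site] (Rr' : ℝ) (Hp : Prop)
    (dB : ℕ) {δ₀ a1 bG αst ρ K1 BG Λ : ℝ}
    (hδ₀ : 0 ≤ δ₀) (hK1 : 0 ≤ K1) (hBG : 0 ≤ BG) (hΛ : 0 ≤ Λ) (hρ : 0 ≤ ρ) (hsplit : αst + ρ ≤ a1)
    (h261 : ∀ c : ↥(cubes (toKT i).D.toDomains), Ineq261 dB (toB6 (geoCK i c) Rr H) δ₀ (bG - ρ))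
    (hST : ∀ c : ↥(cubes (toKT i).D.toDomains), ScaleTransfer (geoCK i c) δ₀ αst Λ (fun a => (geoCK i c).len a ^ 2))
    (hP1 : ∀ c : ↥(cubes (toKT i).D.toDomains), HasMajorant (g := toB6 (geoCK i c) Rr H) (blkBK i c)
      (conj b ((P1CubeY i c (hTY i c) parS (V c)).restrictScalars ℝ))
      (fun a y => K1 * ((geoCK i c).len a ^ 2)⁻¹ * Real.exp (-(a1 * δ₀ * (geoCK i c).dist a y))))
    (hG : ∀ c : ↥(cubes (toKT i).D.toDomains), HasMajorant (g := toB6 (geoCK i c) Rr H) (blkBK i c) (GVK b i c parS parB (V c))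
      (fun y b' => BG * (geoCK i c).len y ^ 2 * Real.exp (-(bG * δ₀ * (geoCK i c).dist y b')))) :
    HasMajorant (g := toB6 (geo9K i) Rr' Hp) (fun p : FBondY i × ι => ιB (blkV1 i.hN i.D p.1))
      (∑ c : ↥(cubes (toKT i).D.toDomains), conj b ((cutMulY (𝔸 := 𝔸) (hBdY i (ζ c)) * locP1BY i c parS (u c) (hTY i c) (V c) *
        locLetterBY i c parS parB (u c) (chiY i c) (V c) * cutMulY (𝔸 := 𝔸) (hBdY i (hTY i c))).restrictScalars ℝ))
      (fun a a' => (3 * 5 ^ (d + 1)) * ((M₂ * ∑ j, ‖b j‖) ^ 2 *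
        ((K1 * BG * Λ * B6.c1 dB δ₀ (bG - ρ)) * Real.exp (-(ρ * δ₀ * (geo9K i).dist a a'))))) := by
  have hκ : 0 ≤ K1 * BG * Λ * B6.c1 dB δ₀ (bG - ρ) := mul_nonneg (mul_nonneg (mul_nonneg hK1 hBG) hΛ) (c1_nonneg _ _ _)
  have hSb : 0 ≤ (M₂ * ∑ j, ‖b j‖) ^ 2 := sq_nonneg _
  refine hasMajorant_localSum_right (G := toB6 (geo9K i) Rr' Hp) (fun p : FBondY i × ι => ιB (blkV1 i.hN i.D p.1))
    (fun c => conj b ((cutMulY (𝔸 := 𝔸) (hBdY i (ζ c)) * locP1BY i c parS (u c) (hTY i c) (V c) *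
        locLetterBY i c parS parB (u c) (chiY i c) (V c) * cutMulY (𝔸 := 𝔸) (hBdY i (hTY i c))).restrictScalars ℝ))
    (fun c a' => if ∃ x : FBondY i, ιB (blkOf i.D.toDomains (chartY i x.src)) = a' ∧
          ∃ z : SiteY i, blkCubeY i c z = blkCubeY i c (chartY i x.src) ∧ hTY i c z ≠ 0 then (1 : ℝ) else 0)
    (fun a a' => (M₂ * ∑ j, ‖b j‖) ^ 2 * ((K1 * BG * Λ * B6.c1 dB δ₀ (bG - ρ)) * Real.exp (-(ρ * δ₀ * (geo9K i).dist a a'))))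
    (3 * 5 ^ (d + 1)) (fun a a' => mul_nonneg hSb (mul_nonneg hκ (Real.exp_nonneg _))) (fun c => ?_) (sum_rowInd_le i ιB hι)
  refine hasMajorant_mono (g := toB6 (geo9K i) Rr' Hp) _
    (hasMajorant_conj_famFour i c parS parB b hM₂ hrepr (u c) (hu c) (V c) (ζ c) (hζ1 c) ιB hι Rr H Rr' Hp dB hδ₀ hK1 hBG hΛ hρ hsplit
      (h261 c) (hST c) (hP1 c) (hG c)) fun a a' => le_of_eq ?_
  split_ifs <;> ring

open Classical in
set_option maxHeartbeats 1600000 in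
/-- ★★ **THE TRANSPOSED FAMILY 4 SUMMED OVER THE COVER** (`hV′`'s word, flat form): α-T per cube with the ROW indicator, `Σ_□ 𝟙_□(a) ≤ 3·5^{d+1}`, `hasMajorant_localSum`.
[cite: Balaban1985BackgroundPropagators, (3.105) p.414, (3.101) p.414, (3.91) p.410, Cor. 3.6 p.408; Balaban1984PropagatorsII, (2.83)–(2.85) pp.237–238, (2.36) p.229, p.235, Lemma 2.1 (2.61) p.234] -/
theorem hasMajorant_sum_famFourT {M₂ : ℝ} (hM₂ : 0 ≤ M₂) (hrepr : ∀ (v : 𝔸) (j : ι), |b.repr v j| ≤ M₂ * ‖v‖)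
    (u : ↥(cubes (toKT i).D.toDomains) → GaugeY 𝔸 i) (hu : ∀ c x, ‖((u c x : 𝔸ˣ) : 𝔸)‖ ≤ 1 ∧ ‖(((u c x)⁻¹ : 𝔸ˣ) : 𝔸)‖ ≤ 1)
    (V : ↥(cubes (toKT i).D.toDomains) → CfgY 𝔸 i)
    (ιB : BlkY i → IBondY i) (hι : ∀ s, β i.hN i.D i.hk (ιB s) = s) (Rr : ℝ) (H : Prop) [Fintype (geo9K i).Site] (Rr' : ℝ) (Hp : Prop)
    (dB : ℕ) {δ₀ a1 bG αst ρ K1 BG Λ α : ℝ}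
    (hδ₀ : 0 ≤ δ₀) (hK1 : 0 ≤ K1) (hBG : 0 ≤ BG) (hΛ : 0 ≤ Λ) (hρ : 0 ≤ ρ) (hsplit : αst + ρ ≤ bG) (hα1 : α ≤ 1)
    (h261 : ∀ c : ↥(cubes (toKT i).D.toDomains), Ineq261 dB (toB6 (geoCK i c) Rr H) δ₀ (a1 - ρ))
    (h261s : ∀ c : ↥(cubes (toKT i).D.toDomains), Ineq261 dB (toB6 (geoCK i c) Rr H) (ρ * δ₀) α)
    (hST : ∀ c : ↥(cubes (toKT i).D.toDomains), ScaleTransfer (geoCK i c) δ₀ αst Λ (fun a => ((geoCK i c).len a ^ 2)⁻¹))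
    (hG : ∀ c : ↥(cubes (toKT i).D.toDomains), HasMajorant (g := toB6 (geoCK i c) Rr H) (blkBK i c) (GVK b i c parS parB (V c))
      (fun a y => BG * (geoCK i c).len a ^ 2 * Real.exp (-(bG * δ₀ * (geoCK i c).dist a y))))
    (hP1 : ∀ c : ↥(cubes (toKT i).D.toDomains), HasMajorant (g := toB6 (geoCK i c) Rr H) (blkBK i c)
      (conj b ((P1CubeY i c (hTY i c) parS (V c)).restrictScalars ℝ))
      (fun y b' => K1 * ((geoCK i c).len y ^ 2)⁻¹ * Real.exp (-(a1 * δ₀ * (geoCK i c).dist y b')))) :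
    HasMajorant (g := toB6 (geo9K i) Rr' Hp) (fun p : FBondY i × ι => ιB (blkV1 i.hN i.D p.1))
      (∑ c : ↥(cubes (toKT i).D.toDomains), conj b ((cutMulY (𝔸 := 𝔸) (hBdY i (hTY i c)) *
        locLetterBY i c parS parB (u c) (chiY i c) (V c) * locP1BY i c parS (u c) (hTY i c) (V c)).restrictScalars ℝ))
      (fun a a' => (3 * 5 ^ (d + 1)) * ((M₂ * ∑ j, ‖b j‖) ^ 2 *
        ((BG * K1 * Λ * B6.c1 dB δ₀ (a1 - ρ) * B6.c1 dB (ρ * δ₀) α) * Real.exp (-((1 - α) * (ρ * δ₀) * (geo9K i).dist a a'))))) := by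
  have hκ : 0 ≤ BG * K1 * Λ * B6.c1 dB δ₀ (a1 - ρ) * B6.c1 dB (ρ * δ₀) α :=
    mul_nonneg (mul_nonneg (mul_nonneg (mul_nonneg hBG hK1) hΛ) (c1_nonneg _ _ _)) (c1_nonneg _ _ _)
  have hSb : 0 ≤ (M₂ * ∑ j, ‖b j‖) ^ 2 := sq_nonneg _
  refine hasMajorant_localSum (G := toB6 (geo9K i) Rr' Hp) (fun p : FBondY i × ι => ιB (blkV1 i.hN i.D p.1))
    (fun c => conj b ((cutMulY (𝔸 := 𝔸) (hBdY i (hTY i c)) *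
        locLetterBY i c parS parB (u c) (chiY i c) (V c) * locP1BY i c parS (u c) (hTY i c) (V c)).restrictScalars ℝ))
    (fun c a => if ∃ x : FBondY i, ιB (blkOf i.D.toDomains (chartY i x.src)) = a ∧
          ∃ z : SiteY i, blkCubeY i c z = blkCubeY i c (chartY i x.src) ∧ hTY i c z ≠ 0 then (1 : ℝ) else 0)
    (fun a a' => (M₂ * ∑ j, ‖b j‖) ^ 2 *
        ((BG * K1 * Λ * B6.c1 dB δ₀ (a1 - ρ) * B6.c1 dB (ρ * δ₀) α) * Real.exp (-((1 - α) * (ρ * δ₀) * (geo9K i).dist a a'))))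
    (3 * 5 ^ (d + 1)) (fun a a' => mul_nonneg hSb (mul_nonneg hκ (Real.exp_nonneg _))) (fun c => ?_) (sum_rowInd_le i ιB hι)
  refine hasMajorant_mono (g := toB6 (geo9K i) Rr' Hp) _
    (hasMajorant_conj_famFourT i c parS parB b hM₂ hrepr (u c) (hu c) (V c) ιB hι Rr H Rr' Hp dB hδ₀ hK1 hBG hΛ hρ hsplit hα1
      (h261 c) (h261s c) (hST c) (hG c) (hP1 c)) fun a a' => le_of_eq ?_
  split_ifs <;> ring

end Cover

/-! ## §2  The datum plug: both sums CLOSED at the localised fields, `(L·M_h)⁻¹` explicit -/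

section AtLocCfg

variable (b : Module.Basis ι ℝ 𝔸)

set_option maxHeartbeats 6400000 in
/-- ★★★ **FAMILY 4 AND ITS TRANSPOSED WORD, SUMMED OVER THE COVER, AT THE LOCALISED FIELDS — CLOSED**: there are `δ₄ > 0`, `Θ₄ ≥ 0`, member thresholds and `a₁ > 0`
such that for every member above threshold, every family of (3.35) cube data with bi-contractive gauges, every family of cut-offs `ζ_□` with `|ζ_□| ≤ 1`, every section:
`Σ_□ conj b((M_{ζ_□}·P^{loc}_{□,1}·O_□·M_{h_□}).rS) ≺ Θ₄·((ℓ+1)·M_h)⁻¹·e^{−δ₄d}` AND `Σ_□ conj b((M_{h_□}·O_□·P^{loc}_{□,1}).rS) ≺ Θ₄·((ℓ+1)·M_h)⁻¹·e^{−δ₄d}` over the member's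
bond carrier — α-1 (`P_{□,1}`), G-F7 v1.1 (`GVK(Ṽ_□)`), `exists_h261_geoCK` (twice), `hST_geoCK`, master rate `δ⋆ = min((1−9∕5000)ρ_G, δ₁)`, `δ₄ = δ⋆∕4`.
[cite: Balaban1985BackgroundPropagators, (3.101) p.414, (3.105) p.414, (3.91) p.410, Cor. 3.6 p.408, (3.42) p.397, (3.49) p.399, p.409 l.1–5; Balaban1984PropagatorsII, (2.83)–(2.85) pp.237–238, (2.36) p.229, p.247, Lemma 2.1 (2.61) p.234] -/
theorem sum_conj_famFour_at_locCfg' [NormOneClass 𝔸] [DecidableEq ι] (hℓ : 1 ≤ ℓ) (hb₀ : 0 < b₀) (hb₁ : b₀ ≤ b₁) (M₂ : ℝ) (hM₂ : 0 ≤ M₂)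
    (hrepr : ∀ (v : 𝔸) (j : ι), |b.repr v j| ≤ M₂ * ‖v‖) :
    ∃ δ₄ Θ₄ M₀ T₀ : ℝ, ∃ N₀ : ℕ, 0 < δ₄ ∧ 0 ≤ Θ₄ ∧ ∃ a₁ : ℝ, 0 < a₁ ∧
    ∀ (i : KIdx d ℓ hd hL b₀ b₁),
      M₀ ≤ ((ℓ : ℝ) + 1) * (toKT i).Mh → N₀ + 1 ≤ (toKT i).R * ((ℓ + 1) * (toKT i).Mh) → T₀ ≤ RM1 i →
    ∀ (u : ↥(cubes (toKT i).D.toDomains) → GaugeY 𝔸 i) (A : ↥(cubes (toKT i).D.toDomains) → AfldY 𝔸 i)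
      (Q : ↥(cubes (toKT i).D.toDomains) → Set (Site (PV d ℓ i.m i.K hd hL) 0)) (C ξ Λ : ↥(cubes (toKT i).D.toDomains) → ℝ),
      (∀ c, 0 ≤ C c) → (∀ c, 0 < ξ c) → (∀ c, 1 ≤ Λ c) → (∀ c, ξ c ≤ 5 * (SC i c : ℝ) * (kGeo i).eta) →
      (∀ c, LatticeNorms.scaleLen ((ℓ : ℝ) + 1) (kGeo i).eta (c.1.1 + 1) ≤ Λ c * ξ c) →
      (∀ c, ∀ x : Site (PV d ℓ i.m i.K hd hL) 0, NearC i c (35 * SC i c / 8 + 1) (boxEquiv i.hN x).1 → x ∈ Q c) →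
      (∀ c κ, ∀ x ∈ Q c, ‖A c κ x‖ ≤ C c * (ξ c)⁻¹) →
      (∀ c μ ν, ∀ x ∈ Q c, ‖(((kGeo i).eta : ℂ)⁻¹) • covD (shiftsV1 (PV d ℓ i.m i.K hd hL)) (fun _ _ => (1 : 𝔸ˣ)) μ (A c ν) x‖ ≤ C c * (ξ c ^ 2)⁻¹) →
      (∀ c (t : ℝ) (κ : Fin (d + 1)) (x : Site (PV d ℓ i.m i.K hd hL) 0), ‖NormedSpace.exp ((I * (t : ℂ)) • A c κ x)‖ ≤ 1) →
      (∀ c, sRead (C c) (Λ c) ≤ a₁) →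
      (∀ c x, ‖((u c x : 𝔸ˣ) : 𝔸)‖ ≤ 1 ∧ ‖(((u c x)⁻¹ : 𝔸ˣ) : 𝔸)‖ ≤ 1) →
    ∀ (ζ : ↥(cubes (toKT i).D.toDomains) → SiteY i → ℝ), (∀ c z, |ζ c z| ≤ 1) →
    ∀ [Fintype (geo9K i).Site] (ιB : BlkY i → IBondY i) (_ : ∀ s, β i.hN i.D i.hk (ιB s) = s) (Rr' : ℝ) (Hp : Prop),
      HasMajorant (g := toB6 (geo9K i) Rr' Hp) (fun p : FBondY i × ι => ιB (blkV1 i.hN i.D p.1))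
        (∑ c : ↥(cubes (toKT i).D.toDomains), conj b ((cutMulY (𝔸 := 𝔸) (hBdY i (ζ c)) *
          locP1BY i c (parSymY i) (u c) (hTY i c) (locCfgY i c (kGeo i).eta (A c)) *
          locLetterBY i c (parSymY i) (parBY i) (u c) (chiY i c) (locCfgY i c (kGeo i).eta (A c)) * cutMulY (𝔸 := 𝔸) (hBdY i (hTY i c))).restrictScalars ℝ))
        (fun a a' => Θ₄ * (((ℓ : ℝ) + 1) * ((toKT i).Mh : ℝ))⁻¹ * Real.exp (-(δ₄ * (geo9K i).dist a a'))) ∧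
      HasMajorant (g := toB6 (geo9K i) Rr' Hp) (fun p : FBondY i × ι => ιB (blkV1 i.hN i.D p.1))
        (∑ c : ↥(cubes (toKT i).D.toDomains), conj b ((cutMulY (𝔸 := 𝔸) (hBdY i (hTY i c)) *
          locLetterBY i c (parSymY i) (parBY i) (u c) (chiY i c) (locCfgY i c (kGeo i).eta (A c)) *
          locP1BY i c (parSymY i) (u c) (hTY i c) (locCfgY i c (kGeo i).eta (A c))).restrictScalars ℝ))
        (fun a a' => Θ₄ * (((ℓ : ℝ) + 1) * ((toKT i).Mh : ℝ))⁻¹ * Real.exp (-(δ₄ * (geo9K i).dist a a'))) := by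
  have hSb : 0 ≤ (M₂ * ∑ j, ‖b j‖) ^ 2 := sq_nonneg _
  have hL1 : (1 : ℝ) ≤ (ℓ : ℝ) + 1 := by linarith [(Nat.cast_nonneg ℓ : (0 : ℝ) ≤ ℓ)]
  -- G-F7 v1.1 and α-1
  obtain ⟨ρ₇, θ₇, M₇, T₇, N₇, hρ₇, hθ₇, a₇, ha₇, AG, hAG, h7⟩ := cor36_G_cube_at_locCfg' b hℓ hb₀ hb₁ M₂ hM₂ hrepr
  obtain ⟨δ₁, K₁, M₁, T₁, N₁, hδ₁, hK₁, aQ, haQ, hQ1⟩ := hasMajorant_conj_P1CubeY_at_locCfg (d := d) (hd := hd) (hL := hL) (b₀ := b₀) (b₁ := b₁) b hℓ M₂ hM₂ hrepr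
  -- the master rate and the two (2.61)
  set δs : ℝ := min ((1 - 9 / 5000) * ρ₇) δ₁ with hδsdef
  have hδs : 0 < δs := lt_min (by positivity) hδ₁
  have hδs₇ : δs ≤ (1 - 9 / 5000) * ρ₇ := min_le_left _ _
  have hδs₁ : δs ≤ δ₁ := min_le_right _ _
  have hδs2 : 0 < 1 / 2 * δs := by positivity
  obtain ⟨dB₁, h261₁⟩ := exists_h261_geoCK d ℓ hδs
  obtain ⟨dB₂, h261₂⟩ := exists_h261_geoCK d ℓ hδs2
  set dB : ℕ := max dB₁ dB₂ with hdBdef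
  have hc1a : 0 ≤ B6.c1 dB δs (1 - 1 / 2) := c1_nonneg _ _ _
  have hc1b : 0 ≤ B6.c1 dB (1 / 2 * δs) (1 / 2) := c1_nonneg _ _ _
  set Λ4 : ℝ := ((ℓ : ℝ) + 1) ^ 4 with hΛ4def
  have hΛ4 : 0 ≤ Λ4 := by positivity
  have hBG : 0 ≤ AG * θ₇ := mul_nonneg hAG hθ₇
  -- one constant dominating both sums: Θ₄ := N·(M₂Σ)²·K₁·(A_Gθ)·Λ4·c₁a·(1 + c₁b)
  set Θ : ℝ := 3 * 5 ^ (d + 1) * ((M₂ * ∑ j, ‖b j‖) ^ 2 * (K₁ * (AG * θ₇) * Λ4 * B6.c1 dB δs (1 - 1 / 2) * (1 + B6.c1 dB (1 / 2 * δs) (1 / 2))))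
    with hΘdef
  have hΘ : 0 ≤ Θ := mul_nonneg (by positivity) (mul_nonneg hSb (mul_nonneg (mul_nonneg (mul_nonneg (mul_nonneg hK₁ hBG) hΛ4) hc1a) (by linarith)))
  refine ⟨1 / 4 * δs, Θ, max M₇ M₁, max T₇ (max T₁ (4 * Real.log ((ℓ : ℝ) + 1) / (9 / 5000 * (1 / 2 * δs)))),
    max N₇ (max N₁ (max (N1 d ℓ (9 / 5000 * δs)) (N1 d ℓ (9 / 5000 * (1 / 2 * δs))))), by positivity, hΘ, min a₇ aQ, lt_min ha₇ haQ, ?_⟩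
  intro i hM hN hT u A Q C ξ Λ hC hξ hΛ hξS hΛξ hQ hA hdA hexp hs hu ζ hζ1 _ ιB hι Rr' Hp
  -- thresholds
  have hM₇ : M₇ ≤ ((ℓ : ℝ) + 1) * (toKT i).Mh := (le_max_left _ _).trans hM
  have hM₁ : M₁ ≤ ((ℓ : ℝ) + 1) * (toKT i).Mh := (le_max_right _ _).trans hM
  have hT₇ : T₇ ≤ RM1 i := (le_max_left _ _).trans hT
  have hT₁ : T₁ ≤ RM1 i := ((le_max_left _ _).trans (le_max_right _ _)).trans hT
  have hTs2 : 4 * Real.log ((ℓ : ℝ) + 1) / (9 / 5000 * (1 / 2 * δs)) ≤ RM1 i := ((le_max_right _ _).trans (le_max_right _ _)).trans hT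
  have hTs : 4 * Real.log ((ℓ : ℝ) + 1) / (9 / 5000 * δs) ≤ RM1 i := by
    refine le_trans ?_ hTs2
    have hlog : 0 ≤ 4 * Real.log ((ℓ : ℝ) + 1) := mul_nonneg (by norm_num) (Real.log_nonneg hL1)
    exact div_le_div_of_nonneg_left hlog (by positivity) (by nlinarith [hδs.le])
  have hNnat := hN
  have hN₇ : N₇ + 1 ≤ (toKT i).R * ((ℓ + 1) * (toKT i).Mh) := le_trans (by simp only [add_le_add_iff_right]; exact le_max_left _ _) hNnat
  have hN₁ : N₁ + 1 ≤ (toKT i).R * ((ℓ + 1) * (toKT i).Mh) :=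
    le_trans (by simp only [add_le_add_iff_right]; exact (le_max_left _ _).trans (le_max_right _ _)) hNnat
  have hNs : N1 d ℓ (9 / 5000 * δs) + 1 ≤ (toKT i).R * ((ℓ + 1) * (toKT i).Mh) :=
    le_trans (by simp only [add_le_add_iff_right]; exact ((le_max_left _ _).trans (le_max_right _ _)).trans (le_max_right _ _)) hNnat
  have hNs2 : N1 d ℓ (9 / 5000 * (1 / 2 * δs)) + 1 ≤ (toKT i).R * ((ℓ + 1) * (toKT i).Mh) :=
    le_trans (by simp only [add_le_add_iff_right]; exact ((le_max_right _ _).trans (le_max_right _ _)).trans (le_max_right _ _)) hNnat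
  have hs₇ : ∀ c, sRead (C c) (Λ c) ≤ a₇ := fun c => (hs c).trans (min_le_left _ _)
  have hsQ : ∀ c, sRead (C c) (Λ c) ≤ aQ := fun c => (hs c).trans (min_le_right _ _)
  -- per cube data at the master rate
  have hhalf : (1 : ℝ) - 1 / 2 = 1 / 2 := by norm_num
  have h261a : ∀ c : ↥(cubes (toKT i).D.toDomains), Ineq261 dB (toB6 (geoCK i c) Rr' Hp) δs (1 - 1 / 2) := fun c => by
    rw [hhalf]
    exact ineq261_mono_exp (by positivity) (le_max_left _ _) (h261₁ i c Rr' Hp hNs (1 / 2) (by norm_num) (by norm_num))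
  have h261b : ∀ c : ↥(cubes (toKT i).D.toDomains), Ineq261 dB (toB6 (geoCK i c) Rr' Hp) (1 / 2 * δs) (1 / 2) := fun c =>
    ineq261_mono_exp (by positivity) (le_max_right _ _) (h261₂ i c Rr' Hp hNs2 (1 / 2) (by norm_num) (by norm_num))
  have hST2 : ∀ c : ↥(cubes (toKT i).D.toDomains), ScaleTransfer (geoCK i c) δs (1 / 10) Λ4 (fun a => (geoCK i c).len a ^ 2) := fun c =>
    ((hST_geoCK i c hδs hTs) (1 / 10) (by norm_num)).2.1
  have hST2i : ∀ c : ↥(cubes (toKT i).D.toDomains), ScaleTransfer (geoCK i c) δs (1 / 10) Λ4 (fun a => ((geoCK i c).len a ^ 2)⁻¹) := fun c =>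
    ((hST_geoCK i c hδs hTs) (1 / 10) (by norm_num)).2.2.2.1
  have hG' : ∀ c : ↥(cubes (toKT i).D.toDomains), HasMajorant (g := toB6 (geoCK i c) Rr' Hp) (blkBK i c)
      (GVK b i c (parSymY i) (parBY i) (locCfgY i c (kGeo i).eta (A c)))
      (fun y b' => (AG * θ₇) * (geoCK i c).len y ^ 2 * Real.exp (-(1 * δs * (geoCK i c).dist y b'))) := fun c => by
    obtain ⟨hdnn, -, -, -⟩ := geoCK_dist_axioms i c Rr' Hp
    have h := (h7 i c Rr' Hp hM₇ hN₇ hT₇ (A c) (Q c) (C c) (ξ c) (Λ c) (hC c) (hξ c) (hΛ c) (hξS c) (hΛξ c) (hQ c) (hA c) (hdA c) (hexp c) (hs₇ c)).2.2.2.2.1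
    refine hasMajorant_mono (g := toB6 (geoCK i c) Rr' Hp) _ h fun a a' => ?_
    rw [one_mul, show AG * θ₇ * (geoCK i c).len a ^ 2 = (AG * θ₇) * (geoCK i c).len a ^ 2 from rfl]
    exact kernel_rate_mono hdnn hδs₇ (mul_nonneg hBG (sq_nonneg _)) a a'
  have hK1 : 0 ≤ K₁ * (((ℓ : ℝ) + 1) * (i.Mh : ℝ))⁻¹ := mul_nonneg hK₁ (inv_nonneg.2 (by positivity))
  have hP1' : ∀ c : ↥(cubes (toKT i).D.toDomains), HasMajorant (g := toB6 (geoCK i c) Rr' Hp) (blkBK i c)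
      (conj b ((P1CubeY i c (hTY i c) (parSymY i) (locCfgY i c (kGeo i).eta (A c))).restrictScalars ℝ))
      (fun a y => (K₁ * (((ℓ : ℝ) + 1) * (i.Mh : ℝ))⁻¹) * ((geoCK i c).len a ^ 2)⁻¹ * Real.exp (-(1 * δs * (geoCK i c).dist a y))) := fun c => by
    obtain ⟨hdnn, -, -, -⟩ := geoCK_dist_axioms i c Rr' Hp
    have h := hQ1 i c Rr' Hp hM₁ hN₁ hT₁ (A c) (Q c) (C c) (ξ c) (Λ c) (hC c) (hξ c) (hΛ c) (hξS c) (hΛξ c) (hQ c) (hA c) (hdA c) (hsQ c)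
    refine hasMajorant_mono (g := toB6 (geoCK i c) Rr' Hp) _ h fun a a' => ?_
    rw [one_mul]
    exact kernel_rate_mono hdnn hδs₁ (mul_nonneg hK1 (inv_nonneg.2 (sq_nonneg _))) a a'
  -- the two cover sums (§1)
  have hF := hasMajorant_sum_famFour i (parSymY i) (parBY i) b hM₂ hrepr u hu (fun c => locCfgY i c (kGeo i).eta (A c)) ζ hζ1 ιB hι Rr' Hp Rr' Hp dB
    (δ₀ := δs) (a1 := 1) (bG := 1) (αst := 1 / 10) (ρ := 1 / 2) (K1 := K₁ * (((ℓ : ℝ) + 1) * (i.Mh : ℝ))⁻¹) (BG := AG * θ₇) (Λ := Λ4)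
    hδs.le hK1 hBG hΛ4 (by norm_num) (by norm_num) h261a hST2 hP1' hG'
  have hFT := hasMajorant_sum_famFourT i (parSymY i) (parBY i) b hM₂ hrepr u hu (fun c => locCfgY i c (kGeo i).eta (A c)) ιB hι Rr' Hp Rr' Hp dB
    (δ₀ := δs) (a1 := 1) (bG := 1) (αst := 1 / 10) (ρ := 1 / 2) (K1 := K₁ * (((ℓ : ℝ) + 1) * (i.Mh : ℝ))⁻¹) (BG := AG * θ₇) (Λ := Λ4) (α := 1 / 2)
    hδs.le hK1 hBG hΛ4 (by norm_num) (by norm_num) (by norm_num) h261a h261b hST2i hG' hP1'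
  -- both kernels are `≤ Θ·(L·M_h)⁻¹·e^{−(δ⋆/4)d}`
  have hMhpos : (0 : ℝ) < ((ℓ : ℝ) + 1) * ((toKT i).Mh : ℝ) := by
    have : (1 : ℝ) ≤ ((toKT i).Mh : ℝ) := by exact_mod_cast B9GeoLemma21KLevelV1.one_le_Mh i
    positivity
  have hMi : (((ℓ : ℝ) + 1) * (i.Mh : ℝ))⁻¹ = (((ℓ : ℝ) + 1) * ((toKT i).Mh : ℝ))⁻¹ := rfl
  have hinv : 0 ≤ (((ℓ : ℝ) + 1) * ((toKT i).Mh : ℝ))⁻¹ := inv_nonneg.2 hMhpos.le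
  refine ⟨hasMajorant_mono (g := toB6 (geo9K i) Rr' Hp) _ hF fun a a' => ?_, hasMajorant_mono (g := toB6 (geo9K i) Rr' Hp) _ hFT fun a a' => ?_⟩
  · have hd := geo9K_dist_nonneg i a a'
    have hexp : Real.exp (-(1 / 2 * δs * (geo9K i).dist a a')) ≤ Real.exp (-(1 / 4 * δs * (geo9K i).dist a a')) :=
      Real.exp_le_exp.2 (by nlinarith [hδs.le])
    rw [hMi]
    have hX : 0 ≤ 3 * 5 ^ (d + 1) * ((M₂ * ∑ j, ‖b j‖) ^ 2 * (K₁ * (AG * θ₇) * Λ4 * B6.c1 dB δs (1 - 1 / 2))) * (((ℓ : ℝ) + 1) * ((toKT i).Mh : ℝ))⁻¹ :=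
      mul_nonneg (mul_nonneg (by positivity) (mul_nonneg hSb (mul_nonneg (mul_nonneg (mul_nonneg hK₁ hBG) hΛ4) hc1a))) hinv
    calc 3 * 5 ^ (d + 1) * ((M₂ * ∑ j, ‖b j‖) ^ 2 *
          (K₁ * (((ℓ : ℝ) + 1) * ((toKT i).Mh : ℝ))⁻¹ * (AG * θ₇) * Λ4 * B6.c1 dB δs (1 - 1 / 2) * Real.exp (-(1 / 2 * δs * (geo9K i).dist a a'))))
        = (3 * 5 ^ (d + 1) * ((M₂ * ∑ j, ‖b j‖) ^ 2 * (K₁ * (AG * θ₇) * Λ4 * B6.c1 dB δs (1 - 1 / 2))) * (((ℓ : ℝ) + 1) * ((toKT i).Mh : ℝ))⁻¹) *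
            Real.exp (-(1 / 2 * δs * (geo9K i).dist a a')) := by ring
      _ ≤ (3 * 5 ^ (d + 1) * ((M₂ * ∑ j, ‖b j‖) ^ 2 * (K₁ * (AG * θ₇) * Λ4 * B6.c1 dB δs (1 - 1 / 2))) * (((ℓ : ℝ) + 1) * ((toKT i).Mh : ℝ))⁻¹) *
            Real.exp (-(1 / 4 * δs * (geo9K i).dist a a')) := mul_le_mul_of_nonneg_left hexp hX
      _ ≤ Θ * (((ℓ : ℝ) + 1) * ((toKT i).Mh : ℝ))⁻¹ * Real.exp (-(1 / 4 * δs * (geo9K i).dist a a')) := by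
          refine mul_le_mul_of_nonneg_right (mul_le_mul_of_nonneg_right ?_ hinv) (Real.exp_nonneg _)
          rw [hΘdef]
          refine mul_le_mul_of_nonneg_left (mul_le_mul_of_nonneg_left ?_ hSb) (by positivity)
          have hY : 0 ≤ K₁ * (AG * θ₇) * Λ4 * B6.c1 dB δs (1 - 1 / 2) := mul_nonneg (mul_nonneg (mul_nonneg hK₁ hBG) hΛ4) hc1a
          nlinarith
  · have hd := geo9K_dist_nonneg i a a'
    have hrate : (1 - 1 / 2) * (1 / 2 * δs) = 1 / 4 * δs := by ring
    rw [hrate, hMi]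
    have hX : 0 ≤ Real.exp (-(1 / 4 * δs * (geo9K i).dist a a')) := Real.exp_nonneg _
    calc 3 * 5 ^ (d + 1) * ((M₂ * ∑ j, ‖b j‖) ^ 2 *
          ((AG * θ₇) * (K₁ * (((ℓ : ℝ) + 1) * ((toKT i).Mh : ℝ))⁻¹) * Λ4 * B6.c1 dB δs (1 - 1 / 2) * B6.c1 dB (1 / 2 * δs) (1 / 2) *
            Real.exp (-(1 / 4 * δs * (geo9K i).dist a a'))))
        = (3 * 5 ^ (d + 1) * ((M₂ * ∑ j, ‖b j‖) ^ 2 * (K₁ * (AG * θ₇) * Λ4 * B6.c1 dB δs (1 - 1 / 2) * B6.c1 dB (1 / 2 * δs) (1 / 2)))) *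
            (((ℓ : ℝ) + 1) * ((toKT i).Mh : ℝ))⁻¹ * Real.exp (-(1 / 4 * δs * (geo9K i).dist a a')) := by ring
      _ ≤ Θ * (((ℓ : ℝ) + 1) * ((toKT i).Mh : ℝ))⁻¹ * Real.exp (-(1 / 4 * δs * (geo9K i).dist a a')) := by
          refine mul_le_mul_of_nonneg_right (mul_le_mul_of_nonneg_right ?_ hinv) hX
          rw [hΘdef]
          refine mul_le_mul_of_nonneg_left (mul_le_mul_of_nonneg_left ?_ hSb) (by positivity)
          have hY : 0 ≤ K₁ * (AG * θ₇) * Λ4 * B6.c1 dB δs (1 - 1 / 2) := mul_nonneg (mul_nonneg (mul_nonneg hK₁ hBG) hΛ4) hc1a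
          nlinarith


/-! ## §3  The transposed sum in the currency `ℓ(a)·ℓ(a′)⁻¹` of `hV′`, closed -/

set_option maxHeartbeats 3200000 in
/-- ★★★ **THE TRANSPOSED FAMILY-4 SUM IN `hV′`'s CURRENCY, CLOSED**: `Σ_□ conj b((M_{h_□}·O_□·P^{loc}_{□,1}).rS) ≺ Θ·((ℓ+1)·M_h)⁻¹·ℓ(a)·ℓ(a′)⁻¹·e^{−δd(a,a′)}`
uniformly in the member — `sum_conj_famFour_at_locCfg'` (second conjunct), D3 `flat_le_src_weight` and D4 `scaleTransfer_len_geo9K` at `(δ₄, ½)` under the size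
condition `log L ≦ ½δ₄(2L²−1)·(L·M_h)` (one more member threshold); `δ = δ₄∕2`, `Θ = Θ₄·L`.
[cite: Balaban1985BackgroundPropagators, (3.101) p.414, (3.105) p.414, p.398 remark after (3.47), Cor. 3.6 p.408; Balaban1984PropagatorsII, (2.83)–(2.85) pp.237–238, Lemma 2.1 (2.60)–(2.61) p.234, (2.46) p.231] -/
theorem sum_conj_famFourT_src_at_locCfg' [NormOneClass 𝔸] [DecidableEq ι] (hℓ : 1 ≤ ℓ) (hb₀ : 0 < b₀) (hb₁ : b₀ ≤ b₁) (M₂ : ℝ) (hM₂ : 0 ≤ M₂)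
    (hrepr : ∀ (v : 𝔸) (j : ι), |b.repr v j| ≤ M₂ * ‖v‖) :
    ∃ δ₄ Θ₄ M₀ T₀ : ℝ, ∃ N₀ : ℕ, 0 < δ₄ ∧ 0 ≤ Θ₄ ∧ ∃ a₁ : ℝ, 0 < a₁ ∧
    ∀ (i : KIdx d ℓ hd hL b₀ b₁),
      M₀ ≤ ((ℓ : ℝ) + 1) * (toKT i).Mh → N₀ + 1 ≤ (toKT i).R * ((ℓ + 1) * (toKT i).Mh) → T₀ ≤ RM1 i →
    ∀ (u : ↥(cubes (toKT i).D.toDomains) → GaugeY 𝔸 i) (A : ↥(cubes (toKT i).D.toDomains) → AfldY 𝔸 i)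
      (Q : ↥(cubes (toKT i).D.toDomains) → Set (Site (PV d ℓ i.m i.K hd hL) 0)) (C ξ Λ : ↥(cubes (toKT i).D.toDomains) → ℝ),
      (∀ c, 0 ≤ C c) → (∀ c, 0 < ξ c) → (∀ c, 1 ≤ Λ c) → (∀ c, ξ c ≤ 5 * (SC i c : ℝ) * (kGeo i).eta) →
      (∀ c, LatticeNorms.scaleLen ((ℓ : ℝ) + 1) (kGeo i).eta (c.1.1 + 1) ≤ Λ c * ξ c) →
      (∀ c, ∀ x : Site (PV d ℓ i.m i.K hd hL) 0, NearC i c (35 * SC i c / 8 + 1) (boxEquiv i.hN x).1 → x ∈ Q c) →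
      (∀ c κ, ∀ x ∈ Q c, ‖A c κ x‖ ≤ C c * (ξ c)⁻¹) →
      (∀ c μ ν, ∀ x ∈ Q c, ‖(((kGeo i).eta : ℂ)⁻¹) • covD (shiftsV1 (PV d ℓ i.m i.K hd hL)) (fun _ _ => (1 : 𝔸ˣ)) μ (A c ν) x‖ ≤ C c * (ξ c ^ 2)⁻¹) →
      (∀ c (t : ℝ) (κ : Fin (d + 1)) (x : Site (PV d ℓ i.m i.K hd hL) 0), ‖NormedSpace.exp ((I * (t : ℂ)) • A c κ x)‖ ≤ 1) →
      (∀ c, sRead (C c) (Λ c) ≤ a₁) →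
      (∀ c x, ‖((u c x : 𝔸ˣ) : 𝔸)‖ ≤ 1 ∧ ‖(((u c x)⁻¹ : 𝔸ˣ) : 𝔸)‖ ≤ 1) →
    ∀ (ζ : ↥(cubes (toKT i).D.toDomains) → SiteY i → ℝ), (∀ c z, |ζ c z| ≤ 1) →
    ∀ [Fintype (geo9K i).Site] (ιB : BlkY i → IBondY i) (_ : ∀ s, β i.hN i.D i.hk (ιB s) = s) (Rr' : ℝ) (Hp : Prop),
      HasMajorant (g := toB6 (geo9K i) Rr' Hp) (fun p : FBondY i × ι => ιB (blkV1 i.hN i.D p.1))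
        (∑ c : ↥(cubes (toKT i).D.toDomains), conj b ((cutMulY (𝔸 := 𝔸) (hBdY i (hTY i c)) *
          locLetterBY i c (parSymY i) (parBY i) (u c) (chiY i c) (locCfgY i c (kGeo i).eta (A c)) *
          locP1BY i c (parSymY i) (u c) (hTY i c) (locCfgY i c (kGeo i).eta (A c))).restrictScalars ℝ))
        (fun a a' => Θ₄ * (((ℓ : ℝ) + 1) * ((toKT i).Mh : ℝ))⁻¹ * (geo9K i).len a * ((geo9K i).len a')⁻¹ * Real.exp (-(δ₄ * (geo9K i).dist a a'))) := by
  have hL1 : (1 : ℝ) ≤ (ℓ : ℝ) + 1 := by linarith [(Nat.cast_nonneg ℓ : (0 : ℝ) ≤ ℓ)]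
  obtain ⟨δE, ΘE, M₀, T₀, N₀, hδE, hΘE, a₁, ha₁, h⟩ := sum_conj_famFour_at_locCfg' b hℓ hb₀ hb₁ M₂ hM₂ hrepr
  have hq : 0 < 2 * ((ℓ : ℝ) + 1) ^ 2 - 1 := by nlinarith
  have hden : 0 < 1 / 2 * δE * (2 * ((ℓ : ℝ) + 1) ^ 2 - 1) := by positivity
  refine ⟨δE / 2, ΘE * ((ℓ : ℝ) + 1), max M₀ (Real.log ((ℓ : ℝ) + 1) / (1 / 2 * δE * (2 * ((ℓ : ℝ) + 1) ^ 2 - 1))), T₀, N₀,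
    by positivity, by positivity, a₁, ha₁, ?_⟩
  intro i hM hN hT u A Q C ξ Λ hC hξ hΛ hξS hΛξ hQ hA hdA hexp hs hu ζ hζ1 _ ιB hι Rr' Hp
  have hM₀ : M₀ ≤ ((ℓ : ℝ) + 1) * (toKT i).Mh := (le_max_left _ _).trans hM
  have h2 := (h i hM₀ hN hT u A Q C ξ Λ hC hξ hΛ hξS hΛξ hQ hA hdA hexp hs hu ζ hζ1 ιB hι Rr' Hp).2
  have hMV : Real.log ((ℓ : ℝ) + 1) ≤ 1 / 2 * δE * (2 * ((ℓ : ℝ) + 1) ^ 2 - 1) * (geo9K i).M := by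
    have hMdef : (geo9K i).M = (((ℓ + 1 : ℕ) : ℝ)) * ((toKT i).Mh : ℝ) := rfl
    have h1 : Real.log ((ℓ : ℝ) + 1) / (1 / 2 * δE * (2 * ((ℓ : ℝ) + 1) ^ 2 - 1)) ≤ ((ℓ : ℝ) + 1) * (toKT i).Mh := (le_max_right _ _).trans hM
    rw [div_le_iff₀ hden] at h1
    calc Real.log ((ℓ : ℝ) + 1) ≤ ((ℓ : ℝ) + 1) * (toKT i).Mh * (1 / 2 * δE * (2 * ((ℓ : ℝ) + 1) ^ 2 - 1)) := h1
      _ = 1 / 2 * δE * (2 * ((ℓ : ℝ) + 1) ^ 2 - 1) * (geo9K i).M := by rw [hMdef]; push_cast; ring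
  have hSTm := scaleTransfer_len_geo9K i (δ := δE) (α := 1 / 2) (by positivity) hMV
  have hMhpos : (0 : ℝ) < ((ℓ : ℝ) + 1) * ((toKT i).Mh : ℝ) := by
    have : (1 : ℝ) ≤ ((toKT i).Mh : ℝ) := by exact_mod_cast B9GeoLemma21KLevelV1.one_le_Mh i
    positivity
  have hinv : 0 ≤ (((ℓ : ℝ) + 1) * ((toKT i).Mh : ℝ))⁻¹ := inv_nonneg.2 hMhpos.le
  refine hasMajorant_mono (g := toB6 (geo9K i) Rr' Hp) _ h2 fun a a' => ?_
  have hκ : 0 ≤ ΘE * (((ℓ : ℝ) + 1) * ((toKT i).Mh : ℝ))⁻¹ := mul_nonneg hΘE hinv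
  have h3 := flat_le_src_weight i (δ := δE) (αm := 1 / 2) (Λm := (ℓ : ℝ) + 1) hκ hSTm a a'
  have e12 : (1 - 1 / 2) * δE = δE / 2 := by ring
  rw [e12] at h3
  calc ΘE * (((ℓ : ℝ) + 1) * ((toKT i).Mh : ℝ))⁻¹ * Real.exp (-(δE * (geo9K i).dist a a'))
      ≤ ΘE * (((ℓ : ℝ) + 1) * ((toKT i).Mh : ℝ))⁻¹ * ((ℓ : ℝ) + 1) * (geo9K i).len a * ((geo9K i).len a')⁻¹ *
          Real.exp (-(δE / 2 * (geo9K i).dist a a')) := h3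
    _ = ΘE * ((ℓ : ℝ) + 1) * (((ℓ : ℝ) + 1) * ((toKT i).Mh : ℝ))⁻¹ * (geo9K i).len a * ((geo9K i).len a')⁻¹ *
          Real.exp (-(δE / 2 * (geo9K i).dist a a')) := by ring

end AtLocCfg

end Literature.MathematicalPhysics.QuantumFieldTheory.Balaban1983to89.B9Cor36GCubeFamFourAtLocCfg

end
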